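import Literature.RepresentationTheory.HeisenbergGroup.LeraySectionUnramifiedParabolic
import Literature.RepresentationTheory.HeisenbergGroup.SchrodingerCommutantPi
import Literature.NumberTheory.Automorphic.LocalFieldHaarBalls
import HarnessLib

/-!
# Spherical vectors of a Darboux-conjugate torus in the Schrödinger model

Topic `RepresentationTheory/HeisenbergGroup`; namespace `Literature.RepresentationTheory.HeisenbergGroup`. KERNEL
mathematics only (theorems; no definition, no named fact, no `axiom`, no `sorry`). Sequel of
`SchrodingerUnramifiedVector.lean` (every implementer of an integral symplectic matrix has `1_{𝒪^ι}` as an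
eigenvector) and `LeraySectionUnramifiedParabolic.lean` (`g Λ ⊆ Λ ⇒ g = transportSp T (A)`, `A ∈ Sp_{2ι}(𝒪)`).

`F` is a non-archimedean local field, `𝒪 = 𝒪_F`, `ϖ` a uniformiser, `q = #k_F`, `ι` a finite index type,
`𝒮 = 𝒮(F^ι)` the Schwartz–Bruhat space, `ρ_T = schrodingerSB β_T ψ` the Schrödinger model of the Heisenberg group of
`W = F^ι × F^ι` with the duality `β_T(x, y) = ᵗx T y` of an invertible symmetric Gram matrix `T`, and
`m(a) = transportSp T (levi a)`, `a ∈ GL_ι(F)`, the Levi elements of the Siegel parabolic of `X = F^ι × 0`.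

## Main statements

* §1 `coe_mem_span_indicator_of_forall_mulVec`, `mem_span_piBallSB_of_forall_mulVec` — **a `GL_ι(𝒪)`-invariant
  Schwartz–Bruhat function on `F^ι` is a finite linear combination of the characteristic functions `1_{(𝔭^m)^ι}`,
  `m ∈ ℤ`** (`GL_ι(𝒪)` acts transitively on each sphere `(𝔭^m)^ι ∖ (𝔭^{m+1})^ι`; a Schwartz–Bruhat function is
  supported in a box and constant on a box around `0`);
* §2 `linearIndependent_indicator_piPrimePowBall`, `linearIndependent_piBallSB` — the `1_{(𝔭^m)^ι}`, `m ∈ ℤ`, are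
  linearly independent (`ι` non-empty);
* §3 `Implements.zpow` (intertwining pairs are stable under integer powers), `implements_transportSp_levi`,
  `coe_leviEquivSB_glEquiv_apply`, `coe_zpow_leviEquivSB_scalar_apply`, `zpow_leviEquivSB_scalar_integersIndicator`,
  `leviEquivSB_map_integersIndicator` — the Levi operator `L_a : Φ ↦ Φ ∘ a⁻¹` implements `m(a)`,
  `(L_{ϖ·1}^j Φ)(x) = Φ(ϖ^{-j} x)`, `L_{ϖ·1}^j 1_{𝒪^ι} = 1_{(𝔭^j)^ι}`, and `L_a 1_{𝒪^ι} = 1_{𝒪^ι}` for `a ∈ GL_ι(𝒪)`;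
* §4 **THE SPHERICAL VECTORS OF A DARBOUX-CONJUGATE TORUS.** Let `γ = transportSp T (A)`, `A ∈ Sp_{2ι}(𝒪)`
  (`T`, `ψ` unramified, `2 ∈ 𝒪^×`, implementers of `ρ_T` unique up to scalars), and let `M` be ANY implementer of the
  conjugate torus element `γ⁻¹ m(ϖ · 1) γ`. Then
  `zpow_apply_integersIndicator_eq_smul` — `M^j 1_{𝒪^ι} ∈ ℂ^× · Γ⁻¹ 1_{(𝔭^j)^ι}` for any implementer `Γ` of `γ`;
  `linearIndependent_zpow_apply_integersIndicator` — **the vectors `M^j 1_{𝒪^ι}`, `j ∈ ℤ`, are linearly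
  independent**;
  `mem_span_zpow_apply_integersIndicator` — **every `u ∈ 𝒮` fixed by the `1_{𝒪^ι}`-normalised implementers of the
  conjugate compact group `γ⁻¹ m(GL_ι(𝒪)) γ` lies in the span of the `M^j 1_{𝒪^ι}`**;
  `linearIndependent_zpow_apply_integersIndicator_of_mapsTo`, `mem_span_zpow_apply_integersIndicator_of_mapsTo` —
  the same two statements for an arbitrary `γ ∈ Sp(W, A_T)` preserving the self-dual lattice `Λ = 𝒪^ι × 𝒪^ι`
  (`T, T⁻¹ ∈ M_ι(𝒪)`), with the uniqueness of implementers of `ρ_T` discharged by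
  `implementerUniqueUpToScalar_schrodingerSB_gram`.
  This is the local representation theory behind the split-place clause of the theta correspondence for the dual
  pair `U(1) × U(N)` of [GelbartRogawski1991] §3.1–§3.2 (at a split place the centre `E_w^× ∋ ϖ_w` of `U(N)(F_v) ≅
  GL_N(F_v)` is a Darboux conjugate of the scalar torus of the Siegel Levi, and its maximal compact subgroup is the
  conjugate of `GL_N(𝒪_v)`): the `U(N)(𝒪_v)`-spherical vectors of the local Weil representation form the free
  rank-one `ℂ[ϖ_w^{±1}]`-module on the unramified vector. Written for the residual `(SPH)` of the stage-1 cell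
  `pub-hodgecm` (supplier chain of `FinLocalSplittings.exists_finset_mk_unitVec_ne_zero_of_sph`); nothing here is
  a claim of the manuscripts adjudicated there.

## References

* C. Mœglin, M.-F. Vignéras, J.-L. Waldspurger, *Correspondances de Howe sur un corps p-adique*, LNM 1291 (1987),
  Chap. 2 II.1 (A)–(B), II.6, II.10 [MoeglinVignerasWaldspurger1987].
* S. Gelbart, J. Rogawski, *L-functions and Fourier–Jacobi coefficients for the unitary group U(3)*, Invent. Math.
  105 (1991), §3.1 (3.1.3), p. 456; §3.2 [GelbartRogawski1991].
* A. Weil, *Sur certains groupes d'opérateurs unitaires*, Acta Math. 111 (1964), n° 6, n° 13 [Weil1964].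
* A. Weil, *Basic Number Theory* (1967), Ch. II §2, Prop. 4; Ch. VII §2 [WeilBNT1967].
-/

set_option autoImplicit false

noncomputable section

namespace Literature.RepresentationTheory.HeisenbergGroup

open _root_.MeasureTheory Matrix ValuativeRel
open Literature.NumberTheory.Automorphic
open Literature.NumberTheory.GaloisRepresentations.IsNonarchimedeanLocalField
open SymplecticMatrix
open scoped NNReal

/-! ## §1 `GL_ι(𝒪)`-invariant Schwartz–Bruhat functions are combinations of boxes -/

section Radial

variable {F : Type*} [Field F] [ValuativeRel F] [TopologicalSpace F] [IsNonarchimedeanLocalField F]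
  {ι : Type*} [Fintype ι] [DecidableEq ι]

omit [TopologicalSpace F] [IsNonarchimedeanLocalField F] in
/-- **an integral column with a unit pivot is the pivot column of an element of `GL_ι(𝒪)`**: for `c ∈ 𝒪^ι` with
`|c_{i₁}| = 1` and `s ∈ F` there is `a ∈ GL_ι(𝒪)` with `a (s e_{i₁}) = s c` (the identity matrix with its `i₁`-th
column replaced by `c`; its determinant is the unit `c_{i₁}`). [cite: WeilBNT1967, Ch. II §2, Prop. 4] -/
theorem exists_gl_mulVec_single_eq {c : ι → F} (hc : ∀ i, c i ∈ 𝒪[F]) {i₁ : ι} (hc₁ : valuation F (c i₁) = 1)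
    (s : F) :
    ∃ a : GL ι 𝒪[F], ((Matrix.GeneralLinearGroup.map (Valuation.integer (valuation F)).subtype a : GL ι F) :
      Matrix ι ι F) *ᵥ Pi.single i₁ s = s • c := by
  set c' : ι → 𝒪[F] := fun i => ⟨c i, hc i⟩ with hc'_def
  have hdet : ((1 : Matrix ι ι 𝒪[F]).updateCol i₁ c').det = c' i₁ := by
    rw [← Matrix.cramer_apply, Matrix.cramer_one]; rfl
  have hunit : IsUnit ((1 : Matrix ι ι 𝒪[F]).updateCol i₁ c').det := by
    rw [hdet]
    exact Valuation.Integers.isUnit_of_one' (Valuation.integer.integers (valuation F)) hc₁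
  refine ⟨Matrix.GeneralLinearGroup.mk'' _ hunit, ?_⟩
  have hval : ((Matrix.GeneralLinearGroup.map (Valuation.integer (valuation F)).subtype
      (Matrix.GeneralLinearGroup.mk'' _ hunit) : GL ι F) : Matrix ι ι F) =
      ((1 : Matrix ι ι 𝒪[F]).updateCol i₁ c').map (Valuation.integer (valuation F)).subtype := rfl
  rw [hval]
  ext i
  simp only [Matrix.mulVec, dotProduct, Pi.single_apply, mul_ite, mul_zero, Finset.sum_ite_eq',
    Finset.mem_univ, if_true, Matrix.map_apply, Matrix.updateCol_self, Pi.smul_apply, smul_eq_mul]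
  rw [mul_comm]; rfl

/-- **`GL_ι(𝒪)` is transitive on the spheres**, in the form: a `GL_ι(𝒪)`-invariant function takes at a point of the
sphere `(𝔭^m)^ι ∖ (𝔭^{m+1})^ι` its value at the diagonal point `(ϖ^m, …, ϖ^m)`. [cite: WeilBNT1967, Ch. II §2, Prop. 4] -/
theorem apply_eq_apply_const_of_mem_sdiff {Φ : (ι → F) → ℂ}
    (hΦ : ∀ (a : GL ι 𝒪[F]) (x : ι → F),
      Φ (((Matrix.GeneralLinearGroup.map (Valuation.integer (valuation F)).subtype a : GL ι F) :
        Matrix ι ι F) *ᵥ x) = Φ x)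
    {t : F} (ht : normAbs F t = (residueFieldCard F : ℝ≥0)⁻¹) {m : ℤ} {x : ι → F}
    (hx : x ∈ piPrimePowBall F ι m) (hx' : x ∉ piPrimePowBall F ι (m + 1)) :
    Φ x = Φ (fun _ => t ^ m) := by
  have hq0 : ((residueFieldCard F : ℝ≥0)⁻¹) ≠ 0 := inv_residueFieldCard_pos.ne'
  have ht0 : t ≠ 0 := by
    rintro rfl
    rw [map_zero] at ht
    exact hq0 ht.symm
  have htm : normAbs F (t ^ m) = ((residueFieldCard F : ℝ≥0)⁻¹) ^ m := by rw [map_zpow₀, ht]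
  have htm0 : t ^ m ≠ 0 := zpow_ne_zero m ht0
  -- a pivot coordinate
  obtain ⟨i₁, hi₁⟩ : ∃ i, x i ∉ primePowBall F (m + 1) :=
    not_forall.1 fun h => hx' (mem_piPrimePowBall_iff.2 h)
  have hxi₁ : normAbs F (x i₁) = ((residueFieldCard F : ℝ≥0)⁻¹) ^ m := by
    refine le_antisymm (mem_piPrimePowBall_iff.1 hx i₁) ?_
    rw [mem_primePowBall_iff, ← LocalFieldHaar.normAbs_lt_zpow_iff, not_lt] at hi₁
    exact hi₁
  -- the rescaled column `c = ϖ^{-m} x` is integral with unit pivot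
  set c : ι → F := fun i => (t ^ m)⁻¹ * x i with hc_def
  have hc : ∀ i, c i ∈ 𝒪[F] := by
    intro i
    rw [← normAbs_le_one_iff, hc_def]
    dsimp only
    rw [map_mul, map_inv₀, htm]
    calc (((residueFieldCard F : ℝ≥0)⁻¹) ^ m)⁻¹ * normAbs F (x i)
        ≤ (((residueFieldCard F : ℝ≥0)⁻¹) ^ m)⁻¹ * ((residueFieldCard F : ℝ≥0)⁻¹) ^ m :=
          mul_le_mul_of_nonneg_left (mem_piPrimePowBall_iff.1 hx i) bot_le
      _ = 1 := inv_mul_cancel₀ (zpow_ne_zero m hq0)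
  have hc₁ : valuation F (c i₁) = 1 := by
    rw [← normAbs_eq_one_iff_valuation_eq_one, hc_def]
    dsimp only
    rw [map_mul, map_inv₀, htm, hxi₁, inv_mul_cancel₀ (zpow_ne_zero m hq0)]
  have hxc : (t ^ m) • c = x := by
    funext i
    rw [Pi.smul_apply, smul_eq_mul, hc_def]
    dsimp only
    rw [mul_inv_cancel_left₀ htm0]
  obtain ⟨a, ha⟩ := exists_gl_mulVec_single_eq hc hc₁ (t ^ m)
  obtain ⟨a', ha'⟩ := exists_gl_mulVec_single_eq (c := fun _ : ι => (1 : F)) (fun _ => one_mem _) (i₁ := i₁)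
    (by rw [map_one]) (t ^ m)
  have h1 : (t ^ m) • (fun _ : ι => (1 : F)) = fun _ => t ^ m := by
    funext i
    rw [Pi.smul_apply, smul_eq_mul, mul_one]
  calc Φ x = Φ (((Matrix.GeneralLinearGroup.map (Valuation.integer (valuation F)).subtype a : GL ι F) :
        Matrix ι ι F) *ᵥ Pi.single i₁ (t ^ m)) := by rw [ha, hxc]
    _ = Φ (Pi.single i₁ (t ^ m)) := hΦ a _
    _ = Φ (((Matrix.GeneralLinearGroup.map (Valuation.integer (valuation F)).subtype a' : GL ι F) :
        Matrix ι ι F) *ᵥ Pi.single i₁ (t ^ m)) := (hΦ a' _).symm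
    _ = Φ (fun _ => t ^ m) := by rw [ha', h1]

/-- **A `GL_ι(𝒪)`-INVARIANT SCHWARTZ–BRUHAT FUNCTION ON `F^ι` IS A FINITE LINEAR COMBINATION OF THE `1_{(𝔭^m)^ι}`,
`m ∈ ℤ`**: with `Φ` supported in `(𝔭^{n₀})^ι` and constant on `(𝔭^{M})^ι`,
`Φ = Σ_{n₀ ≤ m < M} Φ(ϖ^m, …, ϖ^m) (1_{(𝔭^m)^ι} - 1_{(𝔭^{m+1})^ι}) + Φ(0) 1_{(𝔭^M)^ι}`.
[cite: WeilBNT1967, Ch. II §2, Prop. 4; Ch. VII §2, Prop. 2] -/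
theorem coe_mem_span_indicator_of_forall_mulVec {Φ : (ι → F) → ℂ} (hΦS : Φ ∈ SchwartzBruhat (ι → F))
    (hΦ : ∀ (a : GL ι 𝒪[F]) (x : ι → F),
      Φ (((Matrix.GeneralLinearGroup.map (Valuation.integer (valuation F)).subtype a : GL ι F) :
        Matrix ι ι F) *ᵥ x) = Φ x) :
    Φ ∈ Submodule.span ℂ (Set.range fun m : ℤ => (piPrimePowBall F ι m).indicator fun _ => (1 : ℂ)) := by
  obtain ⟨t, -, ht⟩ := exists_normAbs_eq_inv (F := F)
  obtain ⟨n₀, hn₀⟩ := exists_eq_zero_of_notMem_piPrimePowBall hΦS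
  obtain ⟨M₀, hM₀⟩ := exists_forall_add_eq_of_mem_schwartzBruhat_pi hΦS
  set M' : ℤ := max M₀ n₀ with hM'_def
  have hM' : ∀ x ∈ piPrimePowBall F ι M', Φ x = Φ 0 := by
    intro x hx
    have h := hM₀ 0 x (piPrimePowBall_antitone (le_max_left _ _) hx)
    rwa [zero_add] at h
  have key : Φ = (∑ m ∈ Finset.Ico n₀ M', Φ (fun _ => t ^ m) •
      ((piPrimePowBall F ι m).indicator (fun _ => (1 : ℂ)) - (piPrimePowBall F ι (m + 1)).indicator fun _ => (1 : ℂ)))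
      + Φ 0 • (piPrimePowBall F ι M').indicator fun _ => (1 : ℂ) := by
    funext x
    simp only [Pi.add_apply, Finset.sum_apply, Pi.smul_apply, Pi.sub_apply, smul_eq_mul]
    by_cases hxM : x ∈ piPrimePowBall F ι M'
    · rw [hM' x hxM, Set.indicator_of_mem hxM, mul_one, Finset.sum_eq_zero, zero_add]
      intro m hm
      rw [Finset.mem_Ico] at hm
      rw [Set.indicator_of_mem (piPrimePowBall_antitone (show m ≤ M' by omega) hxM),
        Set.indicator_of_mem (piPrimePowBall_antitone (show m + 1 ≤ M' by omega) hxM), sub_self, mul_zero]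
    · rw [Set.indicator_of_notMem hxM, mul_zero, add_zero]
      by_cases hxn : x ∈ piPrimePowBall F ι n₀
      · obtain ⟨m₀, hm₀, hmax⟩ := Int.exists_greatest_of_bdd (P := fun m => x ∈ piPrimePowBall F ι m)
          ⟨M', fun z hz => by
            by_contra h
            exact hxM (piPrimePowBall_antitone (show M' ≤ z by omega) hz)⟩ ⟨n₀, hxn⟩
        have hm₀' : x ∉ piPrimePowBall F ι (m₀ + 1) := fun h => by have := hmax _ h; omega
        have hn₀m₀ : n₀ ≤ m₀ := hmax _ hxn
        have hm₀M' : m₀ < M' := by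
          by_contra h
          exact hxM (piPrimePowBall_antitone (show M' ≤ m₀ by omega) hm₀)
        rw [apply_eq_apply_const_of_mem_sdiff hΦ ht hm₀ hm₀', Finset.sum_eq_single m₀]
        · rw [Set.indicator_of_mem hm₀, Set.indicator_of_notMem hm₀', sub_zero, mul_one]
        · intro m hm hne
          rcases lt_or_gt_of_ne hne with h | h
          · rw [Set.indicator_of_mem (piPrimePowBall_antitone (show m ≤ m₀ by omega) hm₀),
              Set.indicator_of_mem (piPrimePowBall_antitone (show m + 1 ≤ m₀ by omega) hm₀), sub_self, mul_zero]
          · rw [Set.indicator_of_notMem (fun h' => by have := hmax _ h'; omega),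
              Set.indicator_of_notMem (fun h' => by have := hmax _ h'; omega), sub_zero, mul_zero]
        · intro h
          exact absurd (Finset.mem_Ico.2 ⟨hn₀m₀, hm₀M'⟩) h
      · rw [hn₀ x hxn, eq_comm]
        refine Finset.sum_eq_zero fun m hm => ?_
        rw [Finset.mem_Ico] at hm
        rw [Set.indicator_of_notMem (fun h => hxn (piPrimePowBall_antitone (show n₀ ≤ m by omega) h)),
          Set.indicator_of_notMem (fun h => hxn (piPrimePowBall_antitone (show n₀ ≤ m + 1 by omega) h)),
          sub_self, mul_zero]
  rw [key]
  exact Submodule.add_mem _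
    (Submodule.sum_mem _ fun m _ => Submodule.smul_mem _ _
      (Submodule.sub_mem _ (Submodule.subset_span ⟨m, rfl⟩) (Submodule.subset_span ⟨m + 1, rfl⟩)))
    (Submodule.smul_mem _ _ (Submodule.subset_span ⟨M', rfl⟩))

/-- **… the same in `𝒮(F^ι)`**: a `GL_ι(𝒪)`-invariant `Φ ∈ 𝒮(F^ι)` lies in the span of the vectors
`piBallSB m = 1_{(𝔭^m)^ι}`, `m ∈ ℤ`. [cite: WeilBNT1967, Ch. II §2, Prop. 4; Ch. VII §2, Prop. 2] -/
theorem mem_span_piBallSB_of_forall_mulVec (Φ : SchwartzBruhat (ι → F))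
    (hΦ : ∀ (a : GL ι 𝒪[F]) (x : ι → F),
      (Φ : (ι → F) → ℂ) (((Matrix.GeneralLinearGroup.map (Valuation.integer (valuation F)).subtype a : GL ι F) :
        Matrix ι ι F) *ᵥ x) = (Φ : (ι → F) → ℂ) x) :
    Φ ∈ Submodule.span ℂ (Set.range (piBallSB F ι)) := by
  have h := coe_mem_span_indicator_of_forall_mulVec Φ.2 hΦ
  have hr : (Set.range fun m : ℤ => (piPrimePowBall F ι m).indicator fun _ => (1 : ℂ)) =
      (SchwartzBruhat (ι → F)).subtype '' Set.range (piBallSB F ι) := by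
    rw [← Set.range_comp]
    rfl
  rw [hr] at h
  exact (Submodule.apply_mem_span_image_iff_mem_span (SchwartzBruhat (ι → F)).injective_subtype).1 h

/-! ## §2 The boxes `1_{(𝔭^m)^ι}` are linearly independent -/

omit [Fintype ι] [DecidableEq ι] in
/-- **the characteristic functions `1_{(𝔭^m)^ι}`, `m ∈ ℤ`, are linearly independent** (`ι ≠ ∅`): evaluate a
vanishing combination at the points `(ϖ^m, …, ϖ^m)` of the successive spheres. [cite: WeilBNT1967, Ch. II §2] -/
theorem linearIndependent_indicator_piPrimePowBall [Nonempty ι] :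
    LinearIndependent ℂ fun m : ℤ => (piPrimePowBall F ι m).indicator fun _ => (1 : ℂ) := by
  classical
  obtain ⟨t, -, ht⟩ := exists_normAbs_eq_inv (F := F)
  have hmem : ∀ j m : ℤ, (fun _ : ι => t ^ m) ∈ piPrimePowBall F ι j ↔ j ≤ m := by
    intro j m
    rw [mem_piPrimePowBall_iff]
    simp only [mem_primePowBall_iff, map_zpow₀, ht, forall_const]
    exact zpow_le_zpow_iff_right_of_lt_one₀ inv_residueFieldCard_pos inv_residueFieldCard_lt_one
  rw [linearIndependent_iff']
  intro s g hg
  have hS : ∀ m : ℤ, ∑ j ∈ s, (if j ≤ m then g j else 0) = 0 := by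
    intro m
    have h := congr_fun hg (fun _ => t ^ m)
    simp only [Finset.sum_apply, Pi.smul_apply, Pi.zero_apply, smul_eq_mul, Set.indicator_apply, hmem, mul_ite,
      mul_one, mul_zero] at h
    exact h
  intro i hi
  have h1 := hS i
  have hsplit : ∀ j ∈ s, (if j ≤ i then g j else 0) = (if j ≤ i - 1 then g j else 0) + if i = j then g j else 0 := by
    intro j _
    by_cases hji : i = j
    · subst hji
      rw [if_pos le_rfl, if_neg (by omega), if_pos rfl, zero_add]
    · rcases lt_or_gt_of_ne hji with h | h
      · rw [if_neg (by omega), if_neg (by omega), if_neg hji, add_zero]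
      · rw [if_pos h.le, if_pos (by omega), if_neg hji, add_zero]
  rw [Finset.sum_congr rfl hsplit, Finset.sum_add_distrib, hS (i - 1), zero_add, Finset.sum_ite_eq, if_pos hi] at h1
  exact h1

omit [DecidableEq ι] in
/-- **the vectors `piBallSB m = 1_{(𝔭^m)^ι} ∈ 𝒮(F^ι)`, `m ∈ ℤ`, are linearly independent** (`ι ≠ ∅`).
[cite: WeilBNT1967, Ch. II §2] -/
theorem linearIndependent_piBallSB [Nonempty ι] : LinearIndependent ℂ (piBallSB F ι) := by
  refine LinearIndependent.of_comp (SchwartzBruhat (ι → F)).subtype ?_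
  have h : ⇑(SchwartzBruhat (ι → F)).subtype ∘ piBallSB F ι =
      fun m : ℤ => (piPrimePowBall F ι m).indicator fun _ => (1 : ℂ) :=
    funext fun m => coe_piBallSB (F := F) (ι := ι) m
  rw [h]
  exact linearIndependent_indicator_piPrimePowBall

end Radial


/-! ## §3 Integer powers of intertwining pairs; the Levi operators -/

section ImplementsPow

variable {R : Type*} [CommRing R] {V : Type*} [AddCommGroup V] [Module R V] {B : V →ₗ[R] V →ₗ[R] R}
  {k : Type*} [CommSemiring k] {S : Type*} [AddCommMonoid S] [Module k S] (ρ : Representation k (Heisenberg B) S)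

/-- (A) is stable under integer powers: `(s^j, M^j)`. [cite: MoeglinVignerasWaldspurger1987, Chap. 2 II.1 (A)] -/
theorem Implements.zpow {s : Heisenberg.PseudoSymplectic B} {M : S ≃ₗ[k] S} (h : Implements ρ s M) (j : ℤ) :
    Implements ρ (s ^ j) (M ^ j) := by
  induction j using Int.induction_on with
  | zero => rw [zpow_zero, zpow_zero]; exact Implements.one ρ
  | succ n ih => rw [_root_.zpow_add_one, _root_.zpow_add_one]; exact Implements.mul ρ ih h
  | pred n ih => rw [_root_.zpow_sub_one, _root_.zpow_sub_one]; exact Implements.mul ρ ih (Implements.inv ρ h)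

end ImplementsPow

section Levi

variable {F : Type*} [Field F] [ValuativeRel F] [TopologicalSpace F] [IsNonarchimedeanLocalField F]
  {ι : Type*} [Fintype ι] [DecidableEq ι] [Invertible (2 : F)] (T : Matrix ι ι F) (hT : IsUnit T.det)
  {ψ : AddChar F Circle} (hl : IsLocallyConstant (⇑ψ : F → Circle))
  (hbT : ∀ y : ι → F, Continuous fun u : ι → F => Matrix.toLinearMap₂' F T u y)

omit [Invertible (2 : F)] in
/-- `x ↦ a x` is continuous on `F^ι`. [folklore] -/
private theorem continuous_glEquiv (a : GL ι F) : Continuous (glEquiv a) :=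
  ((glEquiv a : (ι → F) ≃ₗ[F] (ι → F)) : (ι → F) →ₗ[F] (ι → F)).continuous_on_pi

omit [Invertible (2 : F)] in
/-- `x ↦ a⁻¹ x` is continuous on `F^ι`. [folklore] -/
private theorem continuous_glEquiv_symm (a : GL ι F) : Continuous (glEquiv a).symm :=
  (((glEquiv a).symm : (ι → F) ≃ₗ[F] (ι → F)) : (ι → F) →ₗ[F] (ι → F)).continuous_on_pi

/-- **the Levi operator `L_a : Φ ↦ Φ ∘ a⁻¹` implements `m(a) = transportSp T (levi a)`** in the Schrödinger model
`ρ_T`, for every `a ∈ GL_ι(F)`. [cite: MoeglinVignerasWaldspurger1987, Chap. 2 II.6; Weil1964, n° 13, p. 160] -/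
theorem implements_transportSp_levi (a : GL ι F) :
    Implements (schrodingerSB (Matrix.toLinearMap₂' F T) ψ hl hbT)
      (ofSymplectic _ (transportSp T hT (levi a)))
      (leviEquivSB (glEquiv a) (continuous_glEquiv a) (continuous_glEquiv_symm a)) := by
  rw [transportSp_levi T hT a]
  exact (mem_MpPsi _ _).1 (levi_mem_MpPsi (Matrix.toLinearMap₂' F T) ψ hl hbT (glEquiv a) (leviDual T hT a)
    (leviDual_compat T hT a) (continuous_glEquiv a) (continuous_glEquiv_symm a))

omit [Invertible (2 : F)] in
/-- `(L_a Φ)(x) = Φ(a⁻¹ x)`. [cite: Weil1964, n° 13, p. 160] -/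
theorem coe_leviEquivSB_glEquiv_apply (a : GL ι F) (Φ : SchwartzBruhat (ι → F)) (x : ι → F) :
    ((leviEquivSB (glEquiv a) (continuous_glEquiv a) (continuous_glEquiv_symm a) Φ : SchwartzBruhat (ι → F)) :
      (ι → F) → ℂ) x = (Φ : (ι → F) → ℂ) (((a⁻¹ : GL ι F) : Matrix ι ι F) *ᵥ x) := by
  rw [coe_leviEquivSB, leviOp_apply, glEquiv_symm_apply]

omit [ValuativeRel F] [TopologicalSpace F] [IsNonarchimedeanLocalField F] [Invertible (2 : F)] in
/-- the inverse of the scalar matrix `t · 1 ∈ GL_ι(F)` is `t⁻¹ · 1`. [folklore] -/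
private theorem coe_inv_of_coe_eq_smul_one {t : F} (ht0 : t ≠ 0) {a₀ : GL ι F}
    (ha₀ : (a₀ : Matrix ι ι F) = t • (1 : Matrix ι ι F)) :
    ((a₀⁻¹ : GL ι F) : Matrix ι ι F) = t⁻¹ • (1 : Matrix ι ι F) :=
  Units.inv_eq_of_mul_eq_one_right (by rw [ha₀, Matrix.smul_mul, Matrix.one_mul, smul_smul, mul_inv_cancel₀ ht0,
    one_smul])

omit [Invertible (2 : F)] in
/-- **powers of the Levi operator of a scalar**: `(L_{t·1}^j Φ)(x) = Φ(t^{-j} x)`, `j ∈ ℤ`.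
[cite: Weil1964, n° 13, p. 160] -/
theorem coe_zpow_leviEquivSB_scalar_apply {t : F} (ht0 : t ≠ 0) {a₀ : GL ι F}
    (ha₀ : (a₀ : Matrix ι ι F) = t • (1 : Matrix ι ι F)) (j : ℤ) (Φ : SchwartzBruhat (ι → F)) (x : ι → F) :
    (((leviEquivSB (glEquiv a₀) (continuous_glEquiv a₀) (continuous_glEquiv_symm a₀) ^ j) Φ :
        SchwartzBruhat (ι → F)) : (ι → F) → ℂ) x = (Φ : (ι → F) → ℂ) ((t ^ j)⁻¹ • x) := by
  -- the operator and its inverse on functions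
  have hL : ∀ (Ψ : SchwartzBruhat (ι → F)) (y : ι → F),
      ((leviEquivSB (glEquiv a₀) (continuous_glEquiv a₀) (continuous_glEquiv_symm a₀) Ψ :
        SchwartzBruhat (ι → F)) : (ι → F) → ℂ) y = (Ψ : (ι → F) → ℂ) (t⁻¹ • y) := by
    intro Ψ y
    rw [coe_leviEquivSB_glEquiv_apply, coe_inv_of_coe_eq_smul_one ht0 ha₀, Matrix.smul_mulVec,
      Matrix.one_mulVec]
  have hL' : ∀ (Ψ : SchwartzBruhat (ι → F)) (y : ι → F),
      (((leviEquivSB (glEquiv a₀) (continuous_glEquiv a₀) (continuous_glEquiv_symm a₀))⁻¹ Ψ :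
        SchwartzBruhat (ι → F)) : (ι → F) → ℂ) y = (Ψ : (ι → F) → ℂ) (t • y) := by
    intro Ψ y
    have h := hL ((leviEquivSB (glEquiv a₀) (continuous_glEquiv a₀) (continuous_glEquiv_symm a₀))⁻¹ Ψ) (t • y)
    rw [← LinearEquiv.mul_apply, mul_inv_cancel, LinearEquiv.coe_one, id_eq, smul_smul, inv_mul_cancel₀ ht0,
      one_smul] at h
    exact h.symm
  induction j using Int.induction_on generalizing Φ x with
  | zero => rw [zpow_zero, zpow_zero, inv_one, one_smul, LinearEquiv.coe_one, id_eq]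
  | succ n ih =>
      rw [_root_.zpow_add_one, LinearEquiv.mul_apply, ih, hL, smul_smul, zpow_add_one₀ ht0, _root_.mul_inv_rev]
  | pred n ih =>
      rw [_root_.zpow_sub_one, LinearEquiv.mul_apply, ih, hL', smul_smul, zpow_sub_one₀ ht0, _root_.mul_inv_rev,
        inv_inv]

omit [Invertible (2 : F)] in
/-- **`L_{ϖ·1}^j 1_{𝒪^ι} = 1_{(𝔭^j)^ι}`** for a uniformiser `ϖ`. [cite: Weil1964, n° 13, p. 160; WeilBNT1967, Ch. II §2] -/
theorem zpow_leviEquivSB_scalar_integersIndicator {t : F} (ht : normAbs F t = (residueFieldCard F : ℝ≥0)⁻¹)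
    {a₀ : GL ι F} (ha₀ : (a₀ : Matrix ι ι F) = t • (1 : Matrix ι ι F)) (Φ₀ : SchwartzBruhat (ι → F))
    (hΦ₀ : (Φ₀ : (ι → F) → ℂ) = (piPrimePowBall F ι 0).indicator fun _ => (1 : ℂ)) (j : ℤ) :
    (leviEquivSB (glEquiv a₀) (continuous_glEquiv a₀) (continuous_glEquiv_symm a₀) ^ j) Φ₀ = piBallSB F ι j := by
  have hq0 : ((residueFieldCard F : ℝ≥0)⁻¹) ≠ 0 := inv_residueFieldCard_pos.ne'
  have ht0 : t ≠ 0 := by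
    rintro rfl
    rw [map_zero] at ht
    exact hq0 ht.symm
  have hti : normAbs F (t ^ j)⁻¹ = ((residueFieldCard F : ℝ≥0)⁻¹) ^ (-j) := by
    rw [map_inv₀, map_zpow₀, ht, _root_.zpow_neg]
  have hmem : ∀ x : ι → F, (t ^ j)⁻¹ • x ∈ piPrimePowBall F ι 0 ↔ x ∈ piPrimePowBall F ι j := by
    intro x
    rw [mem_piPrimePowBall_iff, mem_piPrimePowBall_iff]
    refine forall_congr' fun i => ?_
    rw [Pi.smul_apply, smul_eq_mul, mul_mem_primePowBall_iff hti, zero_sub, neg_neg]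
  apply Subtype.ext
  funext x
  rw [coe_zpow_leviEquivSB_scalar_apply ht0 ha₀, hΦ₀, coe_piBallSB]
  by_cases hx : x ∈ piPrimePowBall F ι j
  · rw [Set.indicator_of_mem hx, Set.indicator_of_mem ((hmem x).2 hx)]
  · rw [Set.indicator_of_notMem hx, Set.indicator_of_notMem (mt (hmem x).1 hx)]

omit [Invertible (2 : F)] in
/-- **`L_a 1_{𝒪^ι} = 1_{𝒪^ι}` for `a ∈ GL_ι(𝒪)`** (`a⁻¹ 𝒪^ι = 𝒪^ι`). [cite: WeilBNT1967, Ch. II §2, Prop. 4] -/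
theorem leviEquivSB_map_integersIndicator {R : Type*} [CommRing R] (f : R →+* F)
    (hf : ∀ r : R, f r ∈ primePowBall F 0) (Φ₀ : SchwartzBruhat (ι → F))
    (hΦ₀ : (Φ₀ : (ι → F) → ℂ) = (piPrimePowBall F ι 0).indicator fun _ => (1 : ℂ)) (a : GL ι R) :
    leviEquivSB (glEquiv (Matrix.GeneralLinearGroup.map f a)) (continuous_glEquiv _) (continuous_glEquiv_symm _)
      Φ₀ = Φ₀ := by
  apply Subtype.ext
  funext u
  rw [coe_leviEquivSB, leviOp_apply, hΦ₀]
  by_cases hu : u ∈ piPrimePowBall F ι 0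
  · rw [Set.indicator_of_mem hu, Set.indicator_of_mem ((glEquiv_map_symm_mem_iff f hf a u).2 hu)]
  · rw [Set.indicator_of_notMem hu, Set.indicator_of_notMem (mt (glEquiv_map_symm_mem_iff f hf a u).1 hu)]

end Levi

/-! ## §4 The spherical vectors of a Darboux-conjugate torus -/

section ConjugateTorus

variable {F : Type*} [Field F] [ValuativeRel F] [TopologicalSpace F] [IsNonarchimedeanLocalField F]
  {ι : Type*} [Fintype ι] [DecidableEq ι] [Invertible (2 : F)] (T : Matrix ι ι F) (hT : IsUnit T.det)
  {ψ : AddChar F Circle} (hl : IsLocallyConstant (⇑ψ : F → Circle))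
  (hbT : ∀ y : ι → F, Continuous fun u : ι → F => Matrix.toLinearMap₂' F T u y)
  (Φ₀ : SchwartzBruhat (ι → F))
  (hΦ₀ : (Φ₀ : (ι → F) → ℂ) = (piPrimePowBall F ι 0).indicator fun _ => (1 : ℂ))
  [MeasurableSpace F] [BorelSpace F] (μ : Measure F) [μ.IsAddHaarMeasure]

include hT μ hΦ₀ in
/-- **`M^j 1_{𝒪^ι} ∈ ℂ^× · Γ⁻¹ 1_{(𝔭^j)^ι}`**: for `γ = transportSp T (A)`, `A ∈ Sp_{2ι}(𝒪)`, with an implementer `Γ`,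
a uniformiser `ϖ` and ANY implementer `M` of the conjugate torus element `γ⁻¹ m(ϖ·1) γ` (model `ρ_T`, `T`, `ψ`
unramified, `2 ∈ 𝒪^×`, implementers unique up to scalars): `M^j 1_{𝒪^ι} = c_j Γ⁻¹ 1_{(𝔭^j)^ι}`, `c_j ∈ ℂ^×`
(`M ∈ ℂ^× Γ⁻¹ L_{ϖ·1} Γ` by uniqueness, `Γ 1_{𝒪^ι} ∈ ℂ^× 1_{𝒪^ι}` by the unramified eigenvector theorem, and
`L_{ϖ·1}^j 1_{𝒪^ι} = 1_{(𝔭^j)^ι}`). [cite: MoeglinVignerasWaldspurger1987, Chap. 2 II.1 (A), II.6, II.10; GelbartRogawski1991, §3.1 (3.1.3), p. 456] -/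
theorem zpow_apply_integersIndicator_eq_smul (hψ : ψ.IsContinuousNontrivial) (hm0 : ψ.HasConductorExp 0)
    (h2 : (⅟(2 : F) : F) ∈ primePowBall F 0)
    (hU : ImplementerUniqueUpToScalar (schrodingerSB (Matrix.toLinearMap₂' F T) ψ hl hbT))
    (A : Matrix.symplecticGroup ι 𝒪[F]) {Γ : SchwartzBruhat (ι → F) ≃ₗ[ℂ] SchwartzBruhat (ι → F)}
    (hΓ : Implements (schrodingerSB (Matrix.toLinearMap₂' F T) ψ hl hbT)
      (ofSymplectic _ (transportSp T hT (mapHom (Valuation.integer (valuation F)).subtype A))) Γ)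
    {t : F} (ht : normAbs F t = (residueFieldCard F : ℝ≥0)⁻¹) {a₀ : GL ι F}
    (ha₀ : (a₀ : Matrix ι ι F) = t • (1 : Matrix ι ι F))
    {M : SchwartzBruhat (ι → F) ≃ₗ[ℂ] SchwartzBruhat (ι → F)}
    (hM : Implements (schrodingerSB (Matrix.toLinearMap₂' F T) ψ hl hbT)
      (ofSymplectic _ ((transportSp T hT (mapHom (Valuation.integer (valuation F)).subtype A))⁻¹ *
        transportSp T hT (levi a₀) * transportSp T hT (mapHom (Valuation.integer (valuation F)).subtype A))) M)
    (j : ℤ) :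
    ∃ c : ℂˣ, (M ^ j) Φ₀ = (c : ℂ) • Γ.symm (piBallSB F ι j) := by
  obtain ⟨cΓ, hcΓ⟩ := exists_smul_integersIndicator_of_implements T hT hl hbT _ integer_subtype_mem Φ₀ hΦ₀
    continuous_dotProductBilin_left μ hψ hm0 h2 hU A hΓ
  set γ := transportSp T hT (mapHom (Valuation.integer (valuation F)).subtype A) with hγ_def
  have hL := implements_transportSp_levi T hT hl hbT a₀ (ψ := ψ)
  have hLj := zpow_leviEquivSB_scalar_integersIndicator ht ha₀ Φ₀ hΦ₀ j
  generalize leviEquivSB (glEquiv a₀) (continuous_glEquiv a₀) (continuous_glEquiv_symm a₀) = L at hL hLj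
  -- `N = Γ⁻¹ L Γ` implements the conjugate torus element, hence so does `N^j` for its `j`-th power
  have hN : Implements (schrodingerSB (Matrix.toLinearMap₂' F T) ψ hl hbT)
      (ofSymplectic _ (γ⁻¹ * transportSp T hT (levi a₀) * γ)) (Γ⁻¹ * L * Γ) := by
    rw [map_mul, map_mul, map_inv]
    exact Implements.mul _ (Implements.mul _ (Implements.inv _ hΓ) hL) hΓ
  have hNj := Implements.zpow _ hN j
  have hMj := Implements.zpow _ hM j
  rw [← map_zpow] at hNj hMj
  obtain ⟨c, hc⟩ := hU _ _ _ hNj hMj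
  refine ⟨c * cΓ, ?_⟩
  have hconj : (Γ⁻¹ * L * Γ) ^ j = Γ⁻¹ * L ^ j * Γ := by
    have h := conj_zpow (a := Γ⁻¹) (b := L) (i := j)
    rwa [inv_inv] at h
  calc (M ^ j) Φ₀ = (c : ℂ) • ((Γ⁻¹ * L * Γ) ^ j) Φ₀ := hc Φ₀
    _ = (c : ℂ) • Γ.symm ((L ^ j) (Γ Φ₀)) := by
        rw [hconj, LinearEquiv.mul_apply, LinearEquiv.mul_apply, LinearEquiv.coe_inv]
    _ = ((c * cΓ : ℂˣ) : ℂ) • Γ.symm (piBallSB F ι j) := by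
        rw [hcΓ, map_smul, hLj, map_smul, smul_smul, Units.val_mul]

include hT μ hΦ₀ in
/-- **THE VECTORS `M^j 1_{𝒪^ι}`, `j ∈ ℤ`, ARE LINEARLY INDEPENDENT** for any implementer `M` of a Darboux-conjugate
torus element `γ⁻¹ m(ϖ·1) γ` (`γ = transportSp T (A)`, `A ∈ Sp_{2ι}(𝒪)`, `ϖ` a uniformiser, `ι ≠ ∅`; model `ρ_T`,
`T`, `ψ` unramified, `2 ∈ 𝒪^×`, implementers unique up to scalars).
[cite: MoeglinVignerasWaldspurger1987, Chap. 2 II.1 (A), II.6, II.10; GelbartRogawski1991, §3.1 (3.1.3), p. 456, §3.2] -/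
theorem linearIndependent_zpow_apply_integersIndicator [Nonempty ι] (hψ : ψ.IsContinuousNontrivial)
    (hm0 : ψ.HasConductorExp 0) (h2 : (⅟(2 : F) : F) ∈ primePowBall F 0)
    (hU : ImplementerUniqueUpToScalar (schrodingerSB (Matrix.toLinearMap₂' F T) ψ hl hbT))
    (A : Matrix.symplecticGroup ι 𝒪[F]) {t : F} (ht : normAbs F t = (residueFieldCard F : ℝ≥0)⁻¹) {a₀ : GL ι F}
    (ha₀ : (a₀ : Matrix ι ι F) = t • (1 : Matrix ι ι F))
    {M : SchwartzBruhat (ι → F) ≃ₗ[ℂ] SchwartzBruhat (ι → F)}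
    (hM : Implements (schrodingerSB (Matrix.toLinearMap₂' F T) ψ hl hbT)
      (ofSymplectic _ ((transportSp T hT (mapHom (Valuation.integer (valuation F)).subtype A))⁻¹ *
        transportSp T hT (levi a₀) * transportSp T hT (mapHom (Valuation.integer (valuation F)).subtype A))) M) :
    LinearIndependent ℂ fun j : ℤ => (M ^ j) Φ₀ := by
  -- an implementer `Γ` of `γ` exists: `Γ⁻¹ := L M⁻¹`… no: take `Γ := L_{a₀}⁻¹`-free route — implementers of
  -- `γ` exist by generation (`existsImplementer_schrodingerSB_gram`); here we extract one from `M` and `L` instead.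
  set γ := transportSp T hT (mapHom (Valuation.integer (valuation F)).subtype A) with hγ_def
  obtain ⟨Γ, hΓ⟩ := existsImplementer_schrodingerSB_gram T hT hl hbT hψ γ
  choose c hc using zpow_apply_integersIndicator_eq_smul T hT hl hbT Φ₀ hΦ₀ μ hψ hm0 h2 hU A hΓ ht ha₀ hM
  have hind : LinearIndependent ℂ (Γ.symm ∘ piBallSB F ι) :=
    (linearIndependent_piBallSB (F := F) (ι := ι)).map' (Γ.symm : SchwartzBruhat (ι → F) →ₗ[ℂ]
      SchwartzBruhat (ι → F)) (LinearEquiv.ker Γ.symm)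
  have he : (fun j : ℤ => (M ^ j) Φ₀) = c • (Γ.symm ∘ piBallSB F ι) := by
    funext j
    rw [hc j, Pi.smul_apply', Function.comp_apply, Units.smul_def]
  rw [he]
  exact hind.units_smul c

include hT μ hΦ₀ in
/-- **EVERY VECTOR FIXED BY THE NORMALISED IMPLEMENTERS OF THE CONJUGATE COMPACT GROUP `γ⁻¹ m(GL_ι(𝒪)) γ` LIES IN THE
SPAN OF THE `M^j 1_{𝒪^ι}`**: if for every `a ∈ GL_ι(𝒪)` some implementer `M_a` of `γ⁻¹ m(a) γ` with
`M_a 1_{𝒪^ι} = 1_{𝒪^ι}` fixes `u ∈ 𝒮(F^ι)`, then `u ∈ span_ℂ {M^j 1_{𝒪^ι} : j ∈ ℤ}` (`M_a = Γ⁻¹ L_a Γ` exactly, so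
`Γ u` is `GL_ι(𝒪)`-invariant, hence a combination of the `1_{(𝔭^j)^ι} ∈ ℂ^× Γ M^j 1_{𝒪^ι}`).
[cite: MoeglinVignerasWaldspurger1987, Chap. 2 II.1 (A), II.6, II.10; GelbartRogawski1991, §3.1 (3.1.3), p. 456, §3.2; WeilBNT1967, Ch. II §2, Prop. 4] -/
theorem mem_span_zpow_apply_integersIndicator (hψ : ψ.IsContinuousNontrivial) (hm0 : ψ.HasConductorExp 0)
    (h2 : (⅟(2 : F) : F) ∈ primePowBall F 0)
    (hU : ImplementerUniqueUpToScalar (schrodingerSB (Matrix.toLinearMap₂' F T) ψ hl hbT))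
    (A : Matrix.symplecticGroup ι 𝒪[F]) {t : F} (ht : normAbs F t = (residueFieldCard F : ℝ≥0)⁻¹) {a₀ : GL ι F}
    (ha₀ : (a₀ : Matrix ι ι F) = t • (1 : Matrix ι ι F))
    {M : SchwartzBruhat (ι → F) ≃ₗ[ℂ] SchwartzBruhat (ι → F)}
    (hM : Implements (schrodingerSB (Matrix.toLinearMap₂' F T) ψ hl hbT)
      (ofSymplectic _ ((transportSp T hT (mapHom (Valuation.integer (valuation F)).subtype A))⁻¹ *
        transportSp T hT (levi a₀) * transportSp T hT (mapHom (Valuation.integer (valuation F)).subtype A))) M)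
    (u : SchwartzBruhat (ι → F))
    (hu : ∀ a : GL ι 𝒪[F], ∃ Ma : SchwartzBruhat (ι → F) ≃ₗ[ℂ] SchwartzBruhat (ι → F),
      Implements (schrodingerSB (Matrix.toLinearMap₂' F T) ψ hl hbT)
        (ofSymplectic _ ((transportSp T hT (mapHom (Valuation.integer (valuation F)).subtype A))⁻¹ *
          transportSp T hT (levi (Matrix.GeneralLinearGroup.map (Valuation.integer (valuation F)).subtype a)) *
          transportSp T hT (mapHom (Valuation.integer (valuation F)).subtype A))) Ma ∧
      Ma Φ₀ = Φ₀ ∧ Ma u = u) :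
    u ∈ Submodule.span ℂ (Set.range fun j : ℤ => (M ^ j) Φ₀) := by
  set γ := transportSp T hT (mapHom (Valuation.integer (valuation F)).subtype A) with hγ_def
  set f := (Valuation.integer (valuation F)).subtype with hf_def
  obtain ⟨Γ, hΓ⟩ := existsImplementer_schrodingerSB_gram T hT hl hbT hψ γ
  obtain ⟨cΓ, hcΓ⟩ := exists_smul_integersIndicator_of_implements T hT hl hbT _ integer_subtype_mem Φ₀ hΦ₀
    continuous_dotProductBilin_left μ hψ hm0 h2 hU A hΓ
  have hΦ₀0 : Φ₀ ≠ 0 := by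
    intro h
    have h1 := congr_fun (congrArg (fun Φ : SchwartzBruhat (ι → F) => (Φ : (ι → F) → ℂ)) h) 0
    simp only [hΦ₀, Set.indicator_of_mem (zero_mem_piPrimePowBall (F := F) (ι := ι) 0), ZeroMemClass.coe_zero,
      Pi.zero_apply, one_ne_zero] at h1
  have hΓs : Γ.symm Φ₀ = ((cΓ⁻¹ : ℂˣ) : ℂ) • Φ₀ := by
    rw [LinearEquiv.symm_apply_eq, map_smul, hcΓ, smul_smul, Units.inv_mul, one_smul]
  -- Step 1: `Γ u` is `GL_ι(𝒪)`-invariant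
  have hinv : ∀ (a : GL ι 𝒪[F]) (x : ι → F), ((Γ u : SchwartzBruhat (ι → F)) : (ι → F) → ℂ)
      (((Matrix.GeneralLinearGroup.map f a : GL ι F) : Matrix ι ι F) *ᵥ x) =
      ((Γ u : SchwartzBruhat (ι → F)) : (ι → F) → ℂ) x := by
    -- for every `b`, `Γ u = L_b (Γ u)`
    have key : ∀ b : GL ι 𝒪[F], leviEquivSB (glEquiv (Matrix.GeneralLinearGroup.map f b)) (continuous_glEquiv _)
        (continuous_glEquiv_symm _) (Γ u) = Γ u := by
      intro b
      obtain ⟨Ma, hMa, hMaΦ₀, hMau⟩ := hu b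
      set Lb := leviEquivSB (glEquiv (Matrix.GeneralLinearGroup.map f b)) (continuous_glEquiv _)
        (continuous_glEquiv_symm _) with hLb_def
      have hLb : Implements (schrodingerSB (Matrix.toLinearMap₂' F T) ψ hl hbT)
          (ofSymplectic _ (transportSp T hT (levi (Matrix.GeneralLinearGroup.map f b)))) Lb :=
        implements_transportSp_levi T hT hl hbT _
      have hNb : Implements (schrodingerSB (Matrix.toLinearMap₂' F T) ψ hl hbT)
          (ofSymplectic _ (γ⁻¹ * transportSp T hT (levi (Matrix.GeneralLinearGroup.map f b)) * γ))
          (Γ⁻¹ * Lb * Γ) := by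
        rw [map_mul, map_mul, map_inv]
        exact Implements.mul _ (Implements.mul _ (Implements.inv _ hΓ) hLb) hΓ
      have hNbΦ₀ : (Γ⁻¹ * Lb * Γ) Φ₀ = Φ₀ := by
        rw [LinearEquiv.mul_apply, LinearEquiv.mul_apply, hcΓ, map_smul,
          leviEquivSB_map_integersIndicator f integer_subtype_mem Φ₀ hΦ₀ b, map_smul, LinearEquiv.coe_inv, hΓs,
          smul_smul, Units.mul_inv, one_smul]
      obtain ⟨c, hc⟩ := hU _ _ _ hNb hMa
      have hc1 : (c : ℂ) = 1 := by
        have h := hc Φ₀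
        rw [hMaΦ₀, hNbΦ₀] at h
        have h' : (c : ℂ) • Φ₀ = (1 : ℂ) • Φ₀ := by rw [one_smul]; exact h.symm
        exact smul_left_injective ℂ hΦ₀0 h'
      have h := hc u
      rw [hMau, hc1, one_smul, LinearEquiv.mul_apply, LinearEquiv.mul_apply, LinearEquiv.coe_inv,
        LinearEquiv.eq_symm_apply] at h
      exact h.symm
    intro a x
    have h := congr_fun (congrArg (fun Φ : SchwartzBruhat (ι → F) => (Φ : (ι → F) → ℂ)) (key a⁻¹)) x
    rw [coe_leviEquivSB_glEquiv_apply, map_inv, inv_inv] at h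
    exact h
  -- Step 2: `Γ u` is a combination of boxes, and `u = Γ⁻¹ (Γ u)`
  have hΓu : Γ u ∈ Submodule.span ℂ (Set.range (piBallSB F ι)) := mem_span_piBallSB_of_forall_mulVec (Γ u) hinv
  have hu' : u ∈ Submodule.span ℂ
      ((Γ.symm : SchwartzBruhat (ι → F) →ₗ[ℂ] SchwartzBruhat (ι → F)) '' Set.range (piBallSB F ι)) := by
    rw [Submodule.span_image]
    exact ⟨Γ u, hΓu, Γ.symm_apply_apply u⟩
  -- Step 3: `Γ⁻¹ 1_{(𝔭^j)^ι} ∈ ℂ^× M^j 1_{𝒪^ι}`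
  refine (Submodule.span_le.2 ?_) hu'
  rintro _ ⟨_, ⟨j, rfl⟩, rfl⟩
  obtain ⟨c, hc⟩ := zpow_apply_integersIndicator_eq_smul T hT hl hbT Φ₀ hΦ₀ μ hψ hm0 h2 hU A hΓ ht ha₀ hM j
  have he : (Γ.symm : SchwartzBruhat (ι → F) →ₗ[ℂ] SchwartzBruhat (ι → F)) (piBallSB F ι j) =
      ((c⁻¹ : ℂˣ) : ℂ) • (M ^ j) Φ₀ := by
    rw [LinearEquiv.coe_coe, hc, smul_smul, Units.inv_mul, one_smul]
  rw [he]
  exact Submodule.smul_mem _ _ (Submodule.subset_span ⟨j, rfl⟩)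


include hT μ hΦ₀ in
/-- **COORDINATE-FREE FORM OF `linearIndependent_zpow_apply_integersIndicator`**: for any `γ ∈ Sp(W, A_T)`
preserving the self-dual lattice `Λ = 𝒪^ι × 𝒪^ι` (`T, T⁻¹ ∈ M_ι(𝒪)`), a uniformiser `ϖ` and any implementer `M`
of `γ⁻¹ m(ϖ·1) γ`, the vectors `M^j 1_{𝒪^ι}`, `j ∈ ℤ`, are linearly independent (`γ = transportSp T (A)`,
`A ∈ Sp_{2ι}(𝒪)`; uniqueness of implementers holds for `ρ_T`).
[cite: MoeglinVignerasWaldspurger1987, Chap. 2 II.1 (A), II.6, II.10; GelbartRogawski1991, §3.1 (3.1.3), p. 456, §3.2] -/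
theorem linearIndependent_zpow_apply_integersIndicator_of_mapsTo [Nonempty ι] (hψ : ψ.IsContinuousNontrivial)
    (hm0 : ψ.HasConductorExp 0) (h2 : (⅟(2 : F) : F) ∈ primePowBall F 0)
    (hTi : ∀ i j, T i j ∈ primePowBall F 0) (hTi' : ∀ i j, T⁻¹ i j ∈ primePowBall F 0)
    (γ : symplecticGroup (polar (Matrix.toLinearMap₂' F T)))
    (hγ : ∀ v ∈ (piPrimePowBall F ι 0) ×ˢ (piPrimePowBall F ι 0),
      (γ : ((ι → F) × (ι → F)) ≃ₗ[F] ((ι → F) × (ι → F))) v ∈ (piPrimePowBall F ι 0) ×ˢ (piPrimePowBall F ι 0))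
    {t : F} (ht : normAbs F t = (residueFieldCard F : ℝ≥0)⁻¹) {a₀ : GL ι F}
    (ha₀ : (a₀ : Matrix ι ι F) = t • (1 : Matrix ι ι F))
    {M : SchwartzBruhat (ι → F) ≃ₗ[ℂ] SchwartzBruhat (ι → F)}
    (hM : Implements (schrodingerSB (Matrix.toLinearMap₂' F T) ψ hl hbT)
      (ofSymplectic _ (γ⁻¹ * transportSp T hT (levi a₀) * γ)) M) :
    LinearIndependent ℂ fun j : ℤ => (M ^ j) Φ₀ := by
  obtain ⟨A, rfl⟩ := exists_eq_transportSp_mapHom_of_mapsTo T hT hTi hTi' γ hγ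
  exact linearIndependent_zpow_apply_integersIndicator T hT hl hbT Φ₀ hΦ₀ μ hψ hm0 h2
    (implementerUniqueUpToScalar_schrodingerSB_gram T hT hl hbT hψ) A ht ha₀ hM

include hT μ hΦ₀ in
/-- **COORDINATE-FREE FORM OF `mem_span_zpow_apply_integersIndicator`**: `γ ∈ Sp(W, A_T)` preserving `Λ`,
`ϖ` a uniformiser, `M` an implementer of `γ⁻¹ m(ϖ·1) γ`; a vector `u` fixed, for every `a ∈ GL_ι(𝒪)`, by an
implementer of `γ⁻¹ m(a) γ` normalised to fix `1_{𝒪^ι}` lies in `span_ℂ {M^j 1_{𝒪^ι}}`.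
[cite: MoeglinVignerasWaldspurger1987, Chap. 2 II.1 (A), II.6, II.10; GelbartRogawski1991, §3.1 (3.1.3), p. 456, §3.2; WeilBNT1967, Ch. II §2, Prop. 4] -/
theorem mem_span_zpow_apply_integersIndicator_of_mapsTo (hψ : ψ.IsContinuousNontrivial)
    (hm0 : ψ.HasConductorExp 0) (h2 : (⅟(2 : F) : F) ∈ primePowBall F 0)
    (hTi : ∀ i j, T i j ∈ primePowBall F 0) (hTi' : ∀ i j, T⁻¹ i j ∈ primePowBall F 0)
    (γ : symplecticGroup (polar (Matrix.toLinearMap₂' F T)))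
    (hγ : ∀ v ∈ (piPrimePowBall F ι 0) ×ˢ (piPrimePowBall F ι 0),
      (γ : ((ι → F) × (ι → F)) ≃ₗ[F] ((ι → F) × (ι → F))) v ∈ (piPrimePowBall F ι 0) ×ˢ (piPrimePowBall F ι 0))
    {t : F} (ht : normAbs F t = (residueFieldCard F : ℝ≥0)⁻¹) {a₀ : GL ι F}
    (ha₀ : (a₀ : Matrix ι ι F) = t • (1 : Matrix ι ι F))
    {M : SchwartzBruhat (ι → F) ≃ₗ[ℂ] SchwartzBruhat (ι → F)}
    (hM : Implements (schrodingerSB (Matrix.toLinearMap₂' F T) ψ hl hbT)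
      (ofSymplectic _ (γ⁻¹ * transportSp T hT (levi a₀) * γ)) M)
    (u : SchwartzBruhat (ι → F))
    (hu : ∀ a : GL ι 𝒪[F], ∃ Ma : SchwartzBruhat (ι → F) ≃ₗ[ℂ] SchwartzBruhat (ι → F),
      Implements (schrodingerSB (Matrix.toLinearMap₂' F T) ψ hl hbT)
        (ofSymplectic _ (γ⁻¹ *
          transportSp T hT (levi (Matrix.GeneralLinearGroup.map (Valuation.integer (valuation F)).subtype a)) * γ))
        Ma ∧ Ma Φ₀ = Φ₀ ∧ Ma u = u) :
    u ∈ Submodule.span ℂ (Set.range fun j : ℤ => (M ^ j) Φ₀) := by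
  obtain ⟨A, rfl⟩ := exists_eq_transportSp_mapHom_of_mapsTo T hT hTi hTi' γ hγ
  exact mem_span_zpow_apply_integersIndicator T hT hl hbT Φ₀ hΦ₀ μ hψ hm0 h2
    (implementerUniqueUpToScalar_schrodingerSB_gram T hT hl hbT hψ) A ht ha₀ hM u hu

end ConjugateTorus

end Literature.RepresentationTheory.HeisenbergGroup
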